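import Summits.BirchSwinnertonDyer.Rank1Residual.X4.KuriharaAdditiveCertificateOfCocycle
import Summits.BirchSwinnertonDyer.Rank1Residual.Additive.PlusSymbolIntegrality
import Summits.BirchSwinnertonDyer.BirchSwinnertonDyer.Theorems.SelmerRankSelmerRankLBStubDeltaParityLemmas
import Literature.NumberTheory.EllipticCurves.PAdicLFunctionDistributionHoldsProofs
import Literature.NumberTheory.EllipticCurves.NewformSymmSquareJ1728Hecke
import HarnessLib

/-!
# The ADDITIVE certificate from the FREE decomposition ALONE, given TWO-PRIME OLD-SPACE EXACTNESS: every `τ_q` EXISTS because `((H_q − a_q)α, (H_q − a_q)β)` lies in the kernel of `(a, b) ↦ (1−[ℓ₁])a + (1−[ℓ₂])b` (the symbol of `f` is Hecke-eigen), and exactness of `z ↦ ((1−[ℓ₂])z, −(1−[ℓ₁])z)` onto that kernel produces it (cell `b2b-bsdres`, seat additive-p4 gen 32, line V54; CLASS-CLOSURE §3.1 N11 SPREAD rows)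

HONEST FRAMING (verbatim, cell `b2b-bsdres`): the goal of the cell is to DELETE the COMBINATION-SHAPED
residual classes for ALL analytic-rank `≤ 1` curves over `ℚ` — "full BSD formula for every rank `≤ 1`
curve in class `C`" assembled STRICTLY from published theorems — so that the rank-`≤ 1` remainder
becomes exactly the CONSTRUCTION-SHAPED classes, which are TYPED (missing-input Props), NOT attempted;
this is not "finishing BSD". This file: research-route KERNEL THEOREMS (pure algebra of periodic
functions + the mod-`p^e` Hecke relation of the plus symbol of `f_E`; no named fact, no conjecture,
nothing booked; X4 stays CONSTRUCTION-SHAPED; no Literature fact is minted; labels unchanged; 0 defs).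

## What is proved

Gen 31's certificate needs, besides the FREE decomposition `\overline{[·]⁺_f} = (1−[ℓ₁])α + (1−[ℓ₂])β`
(instrument E8 FREE, minutes per row), a `τ`-SYSTEM (instrument E9b `thjoint`: a joint linear solve of
≈ 2·10⁴ × 2.6·10³ systems mod `p^k`, which died at its 10-h walls on six rows of gen 30). By
`X4/KuriharaAdditiveCertificateOfCocycle.lean` the `τ`-system is level-1 data `{τ_q}` in an
Ihara-injective module. THIS FILE removes the `τ_q` as data:

* `exists_levelOne_of_exact` — abstract: sets `P₁ ∋ α`, `P₂ ∋ β` stable under the shifted derivatives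
  `E_q = H_q − a_q` (`q ∈ 𝒦`), a set `P₀`, and EXACTNESS: every pair `(g, h) ∈ P₁ × P₂` with
  `(g − g∘[ℓ₁]) + (h − h∘[ℓ₂]) = 0` is `((1−[ℓ₂])z, −(1−[ℓ₁])z)` for some `z ∈ P₀`. If
  `φ = (α − α∘[ℓ₁]) + (β − β∘[ℓ₂])` is killed by every `E_q`, then for every `q ∈ 𝒦` there is
  `τ_q ∈ P₀` with `E_q α = τ_q − τ_q∘[ℓ₂]`, `E_q β = −(τ_q − τ_q∘[ℓ₁])` — because
  `(E_q α, E_q β)` satisfies the kernel equation: its image is `E_q φ = 0`.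
* **`plusSymbolLevelLowersAdditivelyModAt_of_exact`** — THE THEOREM: the FREE decomposition of
  `\overline{[·]⁺_f}` (modulus `m`) with `α ∈ P₁`, `β ∈ P₂`, `E_q`-stable `P₁, P₂`, exactness into an
  `E_q`-stable difference-closed set `P₀` of periodic functions on which `1 − [ℓ₂]` is injective, and
  the Hecke-eigen property of `\overline{[·]⁺_f}` at the Kolyvagin primes ⟹
  `PlusSymbolLevelLowersAdditivelyModAt W p f m ℓ₁ ℓ₂` (via `…_of_levelOne_of_injective`).
* `heckeShift_ratModP_ratPlusSymbol_eq_zero` — the eigen input DISCHARGED for the newform of an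
  elliptic curve: `p` odd, `E[p]` irreducible (every `[r]⁺_f` is `p`-integral,
  `Additive.norm_ratPlusSymbol_le_one_of_irreducible`), `q ∤ N` prime ⟹
  `(H_q − a_q(E)) \overline{[·]⁺_f} = 0` modulo `p^e` (MTT (4.2) `intCast_mul_ratPlusSymbol`, reduced
  with the `ratModP (p^e)` additivity on `p`-integral rationals).
* **`plusSymbolLevelLowersAdditivelyModAt_of_exact_of_isNewformOf`** — for `f = f_E` at modulus
  `p^e`: FREE decomposition + the structural data (`P₁, P₂, P₀`, exactness, injectivity) ⟹ the
  certificate; NO `τ` is supplied.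

WHAT THE STRUCTURAL DATA ARE ON A ROW (not asserted here; EVIDENCE / typed target): `P_i` = an
`H`-stable part of the `ℤ/p^e`-valued plus modular symbols of level `N/ℓ₁`, `N/ℓ₂`, `N/ℓ₁ℓ₂` cut out by
a Hecke idempotent away from the Eisenstein ideals (where the raw kernels of `1 − [ℓ_i]` live, E9), and
EXACTNESS of `Z̄ → Ȳ₁ ⊕ Ȳ₂ → X̄` there — a finite linear-algebra statement per row (instrument E11 of
this line), and as a THEOREM the two-prime analogue of Ihara's lemma at a non-Eisenstein maximal
ideal (typed target T-V54 for ideation; Ribet 1984 Thm. 4.1 is the one-prime statement).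

## References

* B. Mazur, J. Tate, J. Teitelbaum, Invent. Math. 84 (1986), §I.4 (4.2). [cite: MazurTateTeitelbaum1986Invent, §I.4 (4.2)]
* C.-H. Kim, Amer. J. Math. 148 (2026), §1.4.3, §1.5.1. [cite: Kim2022StructureSelmer, §1.4.3 and §1.5.1 (PDF p. 7)]
* K. A. Ribet, Proc. ICM 1983 (1984), Thm. 4.1 (Ihara's lemma; provenance of the exactness/injectivity hypotheses, not an input here). [cite: Ribet1984ICM, Thm. 4.1]
* R. Pollack, T. Weston, Compos. Math. 147 (2011). [cite: PollackWeston2011, Thm. 6.11 of arXiv:math/0610694; provenance, not an input here (printed for p ≥ 5, p ∤ N square-free; the X4 rows are the ANALOGUE at p ∣ N)]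
-/

noncomputable section

open scoped MatrixGroups ModularForm

open CongruenceSubgroup Finset

open Literature.NumberTheory.EllipticCurves Literature.NumberTheory.EllipticCurves.ModularForms

open Literature.NumberTheory.DiophantineGeometry.Dioph (ratModP)

namespace Summit.BirchSwinnertonDyer.Rank1Residual.LevelLowering

/-! ### §1 Abstract: existence of the level-1 `τ` from exactness -/

section Abstract

variable {R : Type*} [CommRing R] (a : ℕ → R) {K : ℕ → Prop}

/-- **EXISTENCE OF `τ_q` FROM EXACTNESS.** `P₁, P₂` stable under `E_q` (`q ∈ 𝒦`, all prime), `ℓ₁, ℓ₂`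
prime to `𝒦`; EXACTNESS: every `(g, h) ∈ P₁ × P₂` with `(g − g∘[ℓ₁]) + (h − h∘[ℓ₂]) = 0` is
`((1−[ℓ₂])z, −(1−[ℓ₁])z)`, `z ∈ P₀`. If `α ∈ P₁`, `β ∈ P₂` are periodic and
`φ = (α − α∘[ℓ₁]) + (β − β∘[ℓ₂])` is killed by `E_q`, then `E_q α = τ − τ∘[ℓ₂]` and
`E_q β = −(τ − τ∘[ℓ₁])` for some `τ ∈ P₀`. [cite: MazurTateTeitelbaum1986Invent, §I.4 (4.2)] -/
theorem exists_levelOne_of_exact (hK : ∀ q, K q → q.Prime) {P₁ P₂ P₀ : Set (ℚ → R)}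
    (hE₁ : ∀ q, K q → ∀ g ∈ P₁, heckeShift a q g ∈ P₁)
    (hE₂ : ∀ q, K q → ∀ g ∈ P₂, heckeShift a q g ∈ P₂)
    {ℓ₁ ℓ₂ : ℕ} (hc₁ : ∀ q, K q → ℓ₁.Coprime q) (hc₂ : ∀ q, K q → ℓ₂.Coprime q)
    (hexact : ∀ g ∈ P₁, ∀ h ∈ P₂, (∀ r, (g r - g (ℓ₁ * r)) + (h r - h (ℓ₂ * r)) = 0) →
      ∃ z ∈ P₀, (g = fun r ↦ z r - z (ℓ₂ * r)) ∧ (h = fun r ↦ -(z r - z (ℓ₁ * r))))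
    {α β : ℚ → R} (hα : IsPeriodic α) (hβ : IsPeriodic β) (hαP : α ∈ P₁) (hβP : β ∈ P₂)
    {φ : ℚ → R} (hsym : ∀ r, φ r = (α r - α (ℓ₁ * r)) + (β r - β (ℓ₂ * r)))
    {q : ℕ} (hq : K q) (heig : heckeShift a q φ = fun _ ↦ 0) :
    ∃ z ∈ P₀, (heckeShift a q α = fun r ↦ z r - z (ℓ₂ * r)) ∧
      (heckeShift a q β = fun r ↦ -(z r - z (ℓ₁ * r))) := by
  refine hexact _ (hE₁ q hq α hαP) _ (hE₂ q hq β hβP) fun r ↦ ?_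
  -- `(E_qα − E_qα∘[ℓ₁]) + (E_qβ − E_qβ∘[ℓ₂]) = E_q φ = 0`
  have hφ : φ = fun r ↦ (fun x ↦ α x - α (ℓ₁ * x)) r + (fun x ↦ β x - β (ℓ₂ * x)) r := by
    funext r; exact hsym r
  have h1 := congrFun (shiftDeriv_sub_comp_natMul a hα (U := {q}) (by simpa using hK q hq)
    (c := ℓ₁) (by simpa using hc₁ q hq)) r
  have h2 := congrFun (shiftDeriv_sub_comp_natMul a hβ (U := {q}) (by simpa using hK q hq)
    (c := ℓ₂) (by simpa using hc₂ q hq)) r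
  have hsing : ∀ γ : ℚ → R, shiftDeriv a γ {q} = heckeShift a q γ := by
    intro γ
    simp [shiftDeriv, shiftDerivList]
  rw [hsing, hsing] at h1 h2
  have h0 := congrFun heig r
  rw [hφ, heckeShift_add] at h0
  simp only at h0
  rw [← h1, ← h2]
  exact h0

end Abstract

/-! ### §2 The certificate from the FREE decomposition + exactness -/

section Certificate

variable {W : WeierstrassCurve ℚ} [W.IsGloballyMinimal] {p : ℕ} {N : ℕ} {f : CuspForm (Gamma0 N) 2}

/-- **THE ADDITIVE CERTIFICATE FROM THE FREE DECOMPOSITION + TWO-PRIME EXACTNESS.** Modulus `m`,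
`E_q = H_q − a_q(E)`, `𝒦 = 𝒫_1(E,p)`, `ℓ₁, ℓ₂ ∣ N_E`. Data: periodic `α ∈ P₁`, `β ∈ P₂` with
`\overline{[r]⁺_f} = (α r − α(ℓ₁ r)) + (β r − β(ℓ₂ r))`; `P₁, P₂` stable under the `E_q`; a set `P₀`
of periodic functions closed under differences and the `E_q`, on which `g ↦ g − g∘[ℓ₂]` is
injective; EXACTNESS of `z ↦ ((1−[ℓ₂])z, −(1−[ℓ₁])z) : P₀ → ker(P₁ × P₂ → ·)`; and the eigen
property `E_q \overline{[·]⁺_f} = 0` at the Kolyvagin primes. Then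
`PlusSymbolLevelLowersAdditivelyModAt W p f m ℓ₁ ℓ₂` — no `τ` supplied.
[cite: Kim2022StructureSelmer, §1.4.3 and §1.5.1 (PDF p. 7)] [cite: Ribet1984ICM, Thm. 4.1] -/
theorem plusSymbolLevelLowersAdditivelyModAt_of_exact {m ℓ₁ ℓ₂ : ℕ}
    (hℓ₁ : ℓ₁ ∣ W.conductorNorm ℤ) (hℓ₂ : ℓ₂ ∣ W.conductorNorm ℤ)
    {α β : ℚ → ZMod m} (hα : IsPeriodic α) (hβ : IsPeriodic β)
    {P₁ P₂ P₀ : Set (ℚ → ZMod m)} (hαP : α ∈ P₁) (hβP : β ∈ P₂)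
    (hE₁ : ∀ q, Kato.IsKolyvaginPrime W p 1 q → ∀ g ∈ P₁,
      heckeShift (fun q ↦ (W.frobeniusTrace q : ZMod m)) q g ∈ P₁)
    (hE₂ : ∀ q, Kato.IsKolyvaginPrime W p 1 q → ∀ g ∈ P₂,
      heckeShift (fun q ↦ (W.frobeniusTrace q : ZMod m)) q g ∈ P₂)
    (hP₀ : ∀ g ∈ P₀, IsPeriodic g)
    (hsub₀ : ∀ g ∈ P₀, ∀ h ∈ P₀, (fun r ↦ g r - h r) ∈ P₀)
    (hE₀ : ∀ q, Kato.IsKolyvaginPrime W p 1 q → ∀ g ∈ P₀,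
      heckeShift (fun q ↦ (W.frobeniusTrace q : ZMod m)) q g ∈ P₀)
    (hinj₀ : ∀ g ∈ P₀, (∀ r, g r - g (ℓ₂ * r) = 0) → g = fun _ ↦ 0)
    (hexact : ∀ g ∈ P₁, ∀ h ∈ P₂, (∀ r, (g r - g (ℓ₁ * r)) + (h r - h (ℓ₂ * r)) = 0) →
      ∃ z ∈ P₀, (g = fun r ↦ z r - z (ℓ₂ * r)) ∧ (h = fun r ↦ -(z r - z (ℓ₁ * r))))
    (heig : ∀ q, Kato.IsKolyvaginPrime W p 1 q →
      heckeShift (fun q ↦ (W.frobeniusTrace q : ZMod m)) q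
        (fun r ↦ ratModP m (ratPlusSymbol f r)) = fun _ ↦ 0)
    (hsym : ∀ r : ℚ, ratModP m (ratPlusSymbol f r) = (α r - α (ℓ₁ * r)) + (β r - β (ℓ₂ * r))) :
    PlusSymbolLevelLowersAdditivelyModAt W p f m ℓ₁ ℓ₂ := by
  classical
  set a : ℕ → ZMod m := fun q ↦ (W.frobeniusTrace q : ZMod m) with ha
  have hK : ∀ q, Kato.IsKolyvaginPrime W p 1 q → q.Prime := fun q hq ↦ hq.prime
  have hc₁ : ∀ q, Kato.IsKolyvaginPrime W p 1 q → ℓ₁.Coprime q :=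
    fun q hq ↦ coprime_of_isKolyvaginPrime_of_dvd hℓ₁ hq
  have hc₂ : ∀ q, Kato.IsKolyvaginPrime W p 1 q → ℓ₂.Coprime q :=
    fun q hq ↦ coprime_of_isKolyvaginPrime_of_dvd hℓ₂ hq
  have hex : ∀ q, Kato.IsKolyvaginPrime W p 1 q → ∃ z ∈ P₀,
      (heckeShift a q α = fun r ↦ z r - z (ℓ₂ * r)) ∧
        (heckeShift a q β = fun r ↦ -(z r - z (ℓ₁ * r))) :=
    fun q hq ↦ exists_levelOne_of_exact a hK hE₁ hE₂ hc₁ hc₂ hexact hα hβ hαP hβP hsym hq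
      (heig q hq)
  -- choose the level-1 data
  let τ₁ : ℕ → ℚ → ZMod m := fun q ↦
    if hq : Kato.IsKolyvaginPrime W p 1 q then (hex q hq).choose else fun _ ↦ 0
  have hτ₁ : ∀ q (hq : Kato.IsKolyvaginPrime W p 1 q), τ₁ q = (hex q hq).choose :=
    fun q hq ↦ dif_pos hq
  refine plusSymbolLevelLowersAdditivelyModAt_of_levelOne_of_injective hℓ₁ hℓ₂ hα hβ hP₀ hsub₀ hE₀
    hinj₀ τ₁ (fun q hq ↦ ?_) (fun q hq ↦ ?_) (fun q hq ↦ ?_) hsym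
  · rw [hτ₁ q hq]; exact (hex q hq).choose_spec.1
  · rw [hτ₁ q hq]; exact (hex q hq).choose_spec.2.1
  · rw [hτ₁ q hq]; exact (hex q hq).choose_spec.2.2

end Certificate

/-! ### §3 The eigen input for the newform of an elliptic curve, modulo `p^e` -/

section Newform

open Summit.BirchSwinnertonDyer.BirchSwinnertonDyer.Theorems (deltaParity_ratModP_add
  deltaParity_ratModP_intCast_mul deltaParity_ratModP_sum deltaParity_norm_sum_le)

variable {W : WeierstrassCurve ℚ} [W.IsElliptic] [W.IsGloballyMinimal] {p : ℕ} [Fact p.Prime]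
  {N : ℕ} [NeZero N] {f : CuspForm (Gamma0 N) 2}

/-- **`(H_q − a_q(E)) \overline{[·]⁺_f} = 0` modulo `p^e`** for the newform `f` of `E = W/ℚ`, `p` odd
with `E[p]` irreducible (so that every `[r]⁺_f` is `p`-integral) and a prime `q ∤ N`: the weight-`2`
Hecke relation `a_q [r]⁺ = ∑_{j mod q} [(r+j)/q]⁺ + [q r]⁺` (MTT (4.2), tree
`intCast_mul_ratPlusSymbol` with Manin–Drinfeld rationality and `a_q(f) = a_q(E)`), reduced by the
additivity of `ratModP (p^e)` on `p`-integral rationals.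
[cite: MazurTateTeitelbaum1986Invent, §I.4 (4.2)] -/
theorem heckeShift_ratModP_ratPlusSymbol_eq_zero (hp2 : p ≠ 2) (hf : IsNewformOf W f)
    (hirr : W.HasIrreducibleModPGaloisRep p) (e : ℕ) {q : ℕ} (hq : q.Prime) (hqN : ¬ q ∣ N) :
    heckeShift (fun q ↦ (W.frobeniusTrace q : ZMod (p ^ e))) q
      (fun r ↦ ratModP (p ^ e) (ratPlusSymbol f r)) = fun _ ↦ 0 := by
  funext r
  have hint : ∀ s : ℚ, ‖((ratPlusSymbol f s : ℚ) : ℚ_[p])‖ ≤ 1 :=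
    fun s ↦ Additive.norm_ratPlusSymbol_le_one_of_irreducible hp2 hf hirr s
  have hrat : ∀ s : ℚ, (ratPlusSymbol f s : ℝ) = normalizedPlusSymbol f s :=
    fun s ↦ ratCast_ratPlusSymbol_holds hf.1 hf.coeffField_eq_bot s
  have hap : cuspCoeff f q = ((W.frobeniusTrace q : ℤ) : ℂ) := hf.cuspCoeff_eq_frobeniusTrace_of_not_dvd hq hqN
  haveI : NeZero q := ⟨hq.ne_zero⟩
  have H := intCast_mul_ratPlusSymbol q hf.1 hq hqN hap hrat r
  -- reduce `H : a_q [r] = ∑_{j : Fin q} [(r+j)/q] + [q r]` modulo `p^e`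
  have Hc := congrArg (ratModP (p ^ e)) H
  rw [deltaParity_ratModP_intCast_mul e _ (hint r),
    deltaParity_ratModP_add e (deltaParity_norm_sum_le _ fun j _ ↦ hint _) (hint _),
    deltaParity_ratModP_sum e _ (fun j _ ↦ hint _)] at Hc
  simp only [heckeShift, heckeTransform]
  rw [Finset.sum_range (fun j ↦ ratModP (p ^ e) (ratPlusSymbol f ((r + j) / q))), ← Hc]
  ring

/-- **THE ADDITIVE CERTIFICATE OF `f_E` FROM ITS FREE DECOMPOSITION + TWO-PRIME EXACTNESS** (modulus
`p^e`, `p` odd, `E[p]` irreducible, `f` the newform of `E` at the conductor level `N = N_E`, so that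
the Kolyvagin primes do not divide `N`): the eigen input of
`plusSymbolLevelLowersAdditivelyModAt_of_exact` is discharged by
`heckeShift_ratModP_ratPlusSymbol_eq_zero`; what remains is the FREE decomposition `(α, β)` and the
STRUCTURAL data `P₁, P₂, P₀` (stability, exactness, injectivity of `1 − [ℓ₂]` on `P₀`) — per row a
finite linear-algebra certificate (EVIDENCE), as a theorem the two-prime Ihara statement at a
non-Eisenstein maximal ideal (typed target). [cite: Kim2022StructureSelmer, §1.4.3 and §1.5.1 (PDF p. 7)]
[cite: Ribet1984ICM, Thm. 4.1] [cite: MazurTateTeitelbaum1986Invent, §I.4 (4.2)] -/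
theorem plusSymbolLevelLowersAdditivelyModAt_of_exact_of_isNewformOf (hp2 : p ≠ 2)
    (hf : IsNewformOf W f) (hirr : W.HasIrreducibleModPGaloisRep p)
    (hN : W.conductorNorm ℤ = N) {e ℓ₁ ℓ₂ : ℕ}
    (hℓ₁ : ℓ₁ ∣ W.conductorNorm ℤ) (hℓ₂ : ℓ₂ ∣ W.conductorNorm ℤ)
    {α β : ℚ → ZMod (p ^ e)} (hα : IsPeriodic α) (hβ : IsPeriodic β)
    {P₁ P₂ P₀ : Set (ℚ → ZMod (p ^ e))} (hαP : α ∈ P₁) (hβP : β ∈ P₂)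
    (hE₁ : ∀ q, Kato.IsKolyvaginPrime W p 1 q → ∀ g ∈ P₁,
      heckeShift (fun q ↦ (W.frobeniusTrace q : ZMod (p ^ e))) q g ∈ P₁)
    (hE₂ : ∀ q, Kato.IsKolyvaginPrime W p 1 q → ∀ g ∈ P₂,
      heckeShift (fun q ↦ (W.frobeniusTrace q : ZMod (p ^ e))) q g ∈ P₂)
    (hP₀ : ∀ g ∈ P₀, IsPeriodic g)
    (hsub₀ : ∀ g ∈ P₀, ∀ h ∈ P₀, (fun r ↦ g r - h r) ∈ P₀)
    (hE₀ : ∀ q, Kato.IsKolyvaginPrime W p 1 q → ∀ g ∈ P₀,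
      heckeShift (fun q ↦ (W.frobeniusTrace q : ZMod (p ^ e))) q g ∈ P₀)
    (hinj₀ : ∀ g ∈ P₀, (∀ r, g r - g (ℓ₂ * r) = 0) → g = fun _ ↦ 0)
    (hexact : ∀ g ∈ P₁, ∀ h ∈ P₂, (∀ r, (g r - g (ℓ₁ * r)) + (h r - h (ℓ₂ * r)) = 0) →
      ∃ z ∈ P₀, (g = fun r ↦ z r - z (ℓ₂ * r)) ∧ (h = fun r ↦ -(z r - z (ℓ₁ * r))))
    (hsym : ∀ r : ℚ, ratModP (p ^ e) (ratPlusSymbol f r) =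
      (α r - α (ℓ₁ * r)) + (β r - β (ℓ₂ * r))) :
    PlusSymbolLevelLowersAdditivelyModAt W p f (p ^ e) ℓ₁ ℓ₂ :=
  plusSymbolLevelLowersAdditivelyModAt_of_exact hℓ₁ hℓ₂ hα hβ hαP hβP hE₁ hE₂ hP₀ hsub₀ hE₀ hinj₀ hexact
    (fun q hq ↦ heckeShift_ratModP_ratPlusSymbol_eq_zero hp2 hf hirr e hq.prime
      fun h ↦ hq.not_dvd_conductorNorm (by rw [hN]; exact_mod_cast h)) hsym

end Newform

end Summit.BirchSwinnertonDyer.Rank1Residual.LevelLowering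

end
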